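import Literature.Analysis.FluidPDE.Wei2016AprioriFact
import Literature.Analysis.FluidPDE.Wei2016DissipationBound
import Literature.Analysis.FluidPDE.Wei2016ThresholdTheta
import Literature.Analysis.FluidPDE.Wei2016Bookkeeping
import Literature.Analysis.FluidPDE.Wei2016RealAssembly
import Literature.Analysis.FluidPDE.LeiZhang2017SwirlL4Apriori
import Literature.Analysis.FluidPDE.LeiZhang2017OmegaThetaApriori
import Literature.Analysis.FluidPDE.LeiZhang2017L4Bound
import Literature.Analysis.FluidPDE.LeiZhang2017AxisymmetricCriteriaProofs
import Literature.Analysis.FluidPDE.SwirlMaximumPrinciple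
import Literature.Analysis.FluidPDE.RapidDecayLemmas
import HarnessLib

/-!
# Wei 2016, Cor. 1.1: the a-priori enstrophy bound is a theorem (discharge of
# `Wei2016_aprioriEnstrophy_logModulus`, `Wei2016_logModulus_regularity`,
# `LeiZhang2017_logModulus_regularity`)

Analysis/FluidPDE proof file (theorems only; no definitions, no named facts): the ASSEMBLY of the
printed proof of

* D. Wei, *Regularity criterion to the axially symmetric Navier–Stokes equations*, J. Math. Anal.
  Appl. 435 (2016) 402–413 = arXiv:1508.03318, Thm. 1.1 and Cor. 1.1 (`|Γ| ≤ |ln r|^{-3/2}` for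
  `0 < r ≤ δ₀ < 1/2` implies global regularity of the strong axisymmetric solution),

from the tree's bricks, each of which formalises one printed step (file → step):

1. `Wei2016ThresholdTheta` (`Wei2016.exists_r₀_threshold_theta`) — the choice of `r₀ ∈ (0, δ₀)` in
   the proof of Cor. 1.1 ("take `r₀` such that `r₀^{-1/2}M₁ ≥ M₀^{1/4}`,
   `C₀M₁r₀^{-1/2} + 1 < e^{-1}r₀^{-1}`"), in the margin version `θ = 9/16` of the tree (Lemma 2.3
   is run with the Hardy constant `θ ε^{-1/3}`, i.e. Wei's `K` at `ε' = θ^{-3/4}ε`, which keeps the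
   fraction `1 − θ` of the dissipation for the end-game);
2. `Wei2016SwirlCriterionProofs` (`Wei2016.K`, `Wei2016.K₀`, `one_add_log_K_add_sq_div_two`,
   `K₀_le_exp_three_mul`) — §1, "one can easily check that `1 + ln K + ½ln²K = ε^{-4/3}`,
   `ε^{4/3}K(ε) ≥ K₀(ε)/C_*`" (`C_* = e³`);
3. `Wei2016AprioriA` (`IsTaoSolutionOn.F_energyA_le`) — §3, (3.1)–(3.7) and the comparison
   "`F(A(0)) − F(A(t)) ≤ C₁M₂‖u₀‖²`" for `A = ‖J‖² + ½ε^{2/3}‖Ω‖²`;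
4. `Wei2016Bookkeeping` (`Wei2016.F_gt_of_threshold`) — "if `C₀ > C_* max{1, √(C₁/3)}`, then (b)
   implies condition (a)' `F(A(0)) > C₁M₂‖u₀‖²`";
5. `Wei2016RealAssembly` (`Wei2016.le_of_F_sub_le`) — "(a)' implies `sup_t A(t) < +∞`";
6. `Wei2016DissipationBound` (`intervalIntegral_dissipation_le`, `exists_radVelQuot_bound`) and the
   Lei–Zhang end-game "as in [8]" (Lei–Zhang 2017, arXiv:1505.02628, §3 p. 9):
   `LeiZhang2017SwirlL4Apriori` (`swirlL4_apriori`: `v^θ ∈ L^∞L⁴`),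
   `LeiZhang2017OmegaThetaApriori` (`omegaTheta_apriori`: `ω^θ ∈ L^∞L²`), `LeiZhang2017L4Bound`
   (`eLpNorm_four_le_of_bounds'`: `v ∈ L^∞L⁴`) and `LeiZhang2017SmallSwirlContinuation`
   (`exists_enstrophy_bound_of_eLpNorm_four_le`: "Serrin type criterion", the `H¹` bound).

Results:

* `Wei2016.exists_parameters` — the real-variable parameter choice of steps 1, 2, 4 (given the
  datum constants, there are `ε, p = ε^{1/3}, K ≥ 1, r₀ < δ₀` with the Hardy relation
  `ε(1 + ln K + ½ln²K) = θ/p`, the threshold `|ln r|^{-3/2} ≤ ε` on `(0, r₀]`, and condition (a)');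
* `Wei2016_aprioriL4_logModulus` — the uniform `L⁴` a-priori bound in Tao's class under (1.6);
* `Wei2016_aprioriEnstrophy_logModulus_holds` — **the discharge** of the named fact
  `Wei2016_aprioriEnstrophy_logModulus` (`Wei2016AprioriFact.lean`);
* `Wei2016_logModulus_regularity_holds` — **Wei 2016, Cor. 1.1** (the named fact
  `Wei2016_logModulus_regularity` of `LeiZhang2017AxisymmetricCriteria.lean`), by the tree's
  one-line assembly `Wei2016_logModulus_regularity_holds_of`;
* `LeiZhang2017_logModulus_regularity_holds` — **Lei–Zhang 2017, Cor. 1.3** (`|Γ| ≤ C/|ln r|²`),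
  by the tree's `LeiZhang2017_logModulus_regularity_of_wei2016`;
* `ChenFangZhang2017.holderSwirl_regularity` — **Chen–Fang–Zhang 2017, Remark 2, unconditional**
  (a Hölder modulus `|Γ| ≤ C r^α` of the swirl at the axis forces regularity): the tree's
  `ChenFangZhang2017_weightedSwirl_regularity.of_holderSwirl` derives it from the (undischarged)
  Thm. 1.1 (1) of Chen–Fang–Zhang; here it follows from Wei's Cor. 1.1, a Hölder modulus being
  eventually below `|ln r|^{-3/2}` (private `exists_delta_holder_le_logModulus`).

Deviations from the printed constants (the fact only asks for SOME bound): `‖u₀‖₂` is replaced by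
`√E(u₀) + 1 > 0` and `C₁` by `C_g + 1` (so that Thm. 1.1's `M₁ > 0`, `C₁ > 0` hold also for the
zero datum), and the margin `θ = 9/16` of `Wei2016ThresholdTheta` is used throughout.

## Mathlib / tree search

Everything analytic is in the tree (the six files above and `IsTaoSolutionOn.abs_swirl_le`,
`SwirlMaximumPrinciple`). `lean search 'Wei2016_aprioriEnstrophy|logModulus_regularity_holds'`:
only the fact, `Wei2016_logModulus_regularity_holds_of` and
`LeiZhang2017_logModulus_regularity_of_wei2016` before this file.

## References

* D. Wei, J. Math. Anal. Appl. 435 (2016) 402–413 = arXiv:1508.03318: §1 (K, K₀), Thm. 1.1,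
  Cor. 1.1, §3 (proof of Thm. 1.1, claim "(b) implies (a)'", proof of Cor. 1.1). [Wei2016]
* Z. Lei, Q. S. Zhang, Pacific J. Math. 289 (2017) 169–187 = arXiv:1505.02628, Cor. 1.3 and §3
  p. 9 (the end-game). [LeiZhang2017]
* T. Tao, Anal. PDE 6 (2013) = arXiv:1108.1165, Thm. 5.4 (the smooth class). [Tao2011]
-/

noncomputable section

open MeasureTheory Set Function Filter
open scoped ENNReal NNReal ContDiff Topology

namespace Literature.Analysis.FluidPDE

/-! ### Two elementary helpers -/

/-- `|g x| ≤ ‖g‖_{L^∞}` for a continuous real `g ∈ L^∞`. [folklore] -/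
private theorem abs_le_toReal_eLpNorm_top_of_continuous {g : EuclideanSpace ℝ (Fin 3) → ℝ}
    (hg : Continuous g) (hfin : eLpNorm g ⊤ volume < ⊤) (x : EuclideanSpace ℝ (Fin 3)) :
    |g x| ≤ (eLpNorm g ⊤ volume).toReal := by
  have h := Literature.Analysis.FunctionSpaces.enorm_le_eLpNorm_top_of_continuous volume hg x
  rw [← ofReal_norm, Real.norm_eq_abs] at h
  exact (ENNReal.ofReal_le_iff_le_toReal hfin.ne).1 h

/-- A bound valid on `[0, T)` for a function continuous on `[0, T]` (`T > 0`) holds on `[0, T]`.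
[folklore] -/
private theorem le_on_Icc_of_le_on_Ico {f : ℝ → ℝ} {T c : ℝ} (hT : 0 < T)
    (hf : ContinuousOn f (Icc 0 T)) (h : ∀ t ∈ Ico 0 T, f t ≤ c) : ∀ t ∈ Icc 0 T, f t ≤ c := by
  intro t ht
  rcases lt_or_eq_of_le ht.2 with hlt | heq
  · exact h t ⟨ht.1, hlt⟩
  · subst heq
    have hcw : ContinuousWithinAt f (Ico 0 t) t := (hf t ht).mono Ico_subset_Icc_self
    have hmem : t ∈ closure (Ico 0 t) := by
      rw [closure_Ico hT.ne]
      exact ⟨ht.1, le_rfl⟩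
    haveI : (𝓝[Ico 0 t] t).NeBot := mem_closure_iff_nhdsWithin_neBot.1 hmem
    exact le_of_tendsto hcw.tendsto (eventually_nhdsWithin_of_forall fun s hs => h s hs)

namespace Wei2016

/-! ### The real-variable parameter choice (proof of Cor. 1.1 + "(b) implies (a)'") -/

set_option maxHeartbeats 800000 in
/-- **The parameters of Wei's energy method under hypothesis (1.6)** (proof of Cor. 1.1 and the
claim "(b) implies (a)'" of the proof of Thm. 1.1, run at the margin `θ = 9/16` of
`Wei2016ThresholdTheta`). Given the datum constants `Γ_b = ‖Γ₀‖_∞ ≥ 0`, `E = E(u₀) ≥ 0`,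
`I_J = ‖J₀‖²₂`, `I_Ω = ‖Ω₀‖²₂` and the energy constant `C_g ≥ 0` of `Wei2016.slice_ode_bound`, and
`δ₀ > 0`, there are `ε ∈ (0, 1]`, `p = ε^{1/3}`, `K ≥ 1` and `r₀ ∈ (0, δ₀)` with
(i) the Hardy relation `ε(1 + ln K + ½ln²K) = θ/p` of Lemma 2.3 (run at `ε' = θ^{-3/4}ε`,
`K = K(ε')`); (ii) `|ln r|^{-3/2} ≤ ε` for `0 < r ≤ r₀` (so (1.6) gives `|Γ| ≤ ε` on `r ≤ r₀`);
(iii) condition (a)': `C_g M₂ E < F(A(0))` with `M₂ = θ + pΓ_b + Γ_b²/p²`,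
`A(0) = I_J + ½p² I_Ω`, `F = Wei2016.F ((εK)^{8/3}) (r₀⁻⁴)`. Here `r₀` is the radius of
`exists_r₀_threshold_theta` for `M₁ = (1 + Γ_b)(√E + 1)`, `M₀ = (√I_J + √I_Ω)M₁³`,
`C₀ = C_* max{1, √(C₁/3)}`, `C_* = (16/9)e³`, `C₁ = C_g + 1`, and
`ε' = (1 + ln(C₀r₀^{-1/2}M₁ + 1))^{-3/2}` is (3.4), so that `K₀(ε') = C₀r₀^{-1/2}M₁ + 1` and
`F_gt_of_threshold` applies. [cite: Wei2016, proof of Cor. 1.1 and proof of Thm. 1.1 ((3.4), "(b) implies (a)'")] -/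
theorem exists_parameters {δ₀ Γb KE IJ IΩ Cg : ℝ} (hδ₀ : 0 < δ₀) (hΓb : 0 ≤ Γb) (hKE : 0 ≤ KE)
    (hIJ : 0 ≤ IJ) (hIΩ : 0 ≤ IΩ) (hCg : 0 ≤ Cg) :
    ∃ ε p K r₀ : ℝ, 0 < ε ∧ ε ≤ 1 ∧ 0 < p ∧ p ^ 3 = ε ∧ 1 ≤ K ∧ 0 < r₀ ∧ r₀ < δ₀ ∧
      ε * (1 + Real.log K + Real.log K ^ 2 / 2) = 9 / 16 / p ∧
      (∀ r : ℝ, 0 < r → r ≤ r₀ → |Real.log r| ^ (-(3 / 2 : ℝ)) ≤ ε) ∧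
      Cg * (9 / 16 + p * Γb + Γb ^ 2 / p ^ 2) * KE <
        F ((ε * K) ^ (8 / 3 : ℝ)) ((r₀ ^ 4)⁻¹) (IJ + p ^ 2 / 2 * IΩ) := by
  -- the datum-side constants of Thm. 1.1 (with `‖u₀‖₂ ↦ √E + 1`, `C₁ = C_g + 1`)
  obtain ⟨E₀, hE₀⟩ : ∃ E₀ : ℝ, E₀ = Real.sqrt KE + 1 := ⟨_, rfl⟩
  obtain ⟨N₀, hN₀⟩ : ∃ N₀ : ℝ, N₀ = Real.sqrt IJ + Real.sqrt IΩ := ⟨_, rfl⟩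
  obtain ⟨M₁, hM₁⟩ : ∃ M₁ : ℝ, M₁ = (1 + Γb) * E₀ := ⟨_, rfl⟩
  obtain ⟨C₁, hC₁⟩ : ∃ C₁ : ℝ, C₁ = Cg + 1 := ⟨_, rfl⟩
  obtain ⟨Cs, hCs⟩ : ∃ Cs : ℝ, Cs = Real.exp 3 * (16 / 9) := ⟨_, rfl⟩
  obtain ⟨C₀, hC₀⟩ : ∃ C₀ : ℝ, C₀ = Cs * max 1 (Real.sqrt (C₁ / 3)) := ⟨_, rfl⟩
  have hE₀0 : 0 < E₀ := by rw [hE₀]; positivity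
  have hN₀0 : 0 ≤ N₀ := by rw [hN₀]; positivity
  have hM₁0 : 0 < M₁ := by rw [hM₁]; positivity
  have hC₁0 : 0 < C₁ := by rw [hC₁]; positivity
  have hCs0 : 0 < Cs := by rw [hCs]; positivity
  have hC₀0 : 0 ≤ C₀ := by rw [hC₀]; positivity
  -- the radius `r₀` of Cor. 1.1 (margin `θ = 9/16`)
  obtain ⟨r₀, hr₀, hr₀δ, hr₀1, hmax, hthr⟩ :=
    exists_r₀_threshold_theta (M₀ := N₀ * M₁ ^ 3) (C₀ := C₀) hδ₀ (by positivity) hM₁0 hC₀0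
  -- Wei's `ε` of (3.4) at the margin parameter (`ε'`), and the tree's `ε = (3/4)^{3/2} ε'`
  obtain ⟨X, hX⟩ : ∃ X : ℝ, X = C₀ * (r₀ ^ (-(1 / 2 : ℝ)) * M₁) := ⟨_, rfl⟩
  have hX0 : 0 ≤ X := by
    rw [hX]; exact mul_nonneg hC₀0 (mul_nonneg (Real.rpow_nonneg hr₀.le _) hM₁0.le)
  obtain ⟨L, hL⟩ : ∃ L : ℝ, L = 1 + Real.log (X + 1) := ⟨_, rfl⟩
  have hL1 : 1 ≤ L := by
    have := Real.log_nonneg (show (1 : ℝ) ≤ X + 1 by linarith)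
    rw [hL]; linarith
  have hL0 : 0 < L := by linarith
  obtain ⟨ε', hε'⟩ : ∃ e : ℝ, e = L ^ (-(3 / 2 : ℝ)) := ⟨_, rfl⟩
  have hε'0 : 0 < ε' := by rw [hε']; exact Real.rpow_pos_of_pos hL0 _
  have hε'1 : ε' ≤ 1 := by rw [hε']; exact Real.rpow_le_one_of_one_le_of_nonpos hL1 (by norm_num)
  rw [← hX, ← hL, ← hε'] at hthr
  obtain ⟨c, hc⟩ : ∃ c : ℝ, c = (3 / 4 : ℝ) ^ (3 / 2 : ℝ) := ⟨_, rfl⟩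
  have hc0 : 0 < c := by rw [hc]; exact Real.rpow_pos_of_pos (by norm_num) _
  have hc1 : c ≤ 1 := by rw [hc]; exact Real.rpow_le_one (by norm_num) (by norm_num) (by norm_num)
  obtain ⟨ε, hε⟩ : ∃ e : ℝ, e = c * ε' := ⟨_, rfl⟩
  have hε0 : 0 < ε := by rw [hε]; exact mul_pos hc0 hε'0
  have hεε' : ε ≤ ε' := by rw [hε]; exact mul_le_of_le_one_left hε'0.le hc1
  have hε1 : ε ≤ 1 := hεε'.trans hε'1
  obtain ⟨p, hp⟩ : ∃ q : ℝ, q = ε ^ (1 / 3 : ℝ) := ⟨_, rfl⟩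
  have hp0 : 0 < p := by rw [hp]; exact Real.rpow_pos_of_pos hε0 _
  have hp3 : p ^ 3 = ε := by
    rw [hp, ← Real.rpow_natCast, ← Real.rpow_mul hε0.le]; norm_num
  have hp1 : p ≤ 1 := by rw [hp]; exact Real.rpow_le_one hε0.le hε1 (by norm_num)
  have hp2 : p ^ 2 = ε ^ (2 / 3 : ℝ) := by
    rw [hp, ← Real.rpow_natCast, ← Real.rpow_mul hε0.le]; norm_num
  -- `K = K(ε') ≥ 1`
  have hK1 : 1 ≤ K ε' := by
    rw [K]
    refine Real.one_le_exp ?_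
    have hs : 1 ≤ ε' ^ (-(4 / 3 : ℝ)) :=
      Real.one_le_rpow_of_pos_of_le_one_of_nonpos hε'0 hε'1 (by norm_num)
    have h1 : 1 ≤ Real.sqrt (2 * ε' ^ (-(4 / 3 : ℝ)) - 1) := by
      rw [show (1 : ℝ) = Real.sqrt 1 from Real.sqrt_one.symm]
      exact Real.sqrt_le_sqrt (by linarith)
    linarith
  -- (i) the Hardy relation `ε (1 + ln K + ½ ln² K) = (9/16)/p`
  have hlogK : 1 + Real.log (K ε') + Real.log (K ε') ^ 2 / 2 = ε' ^ (-(4 / 3 : ℝ)) :=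
    one_add_log_K_add_sq_div_two hε'0 hε'1
  have hc43 : c ^ (4 / 3 : ℝ) = 9 / 16 := by
    rw [hc, ← Real.rpow_mul (by norm_num : (0 : ℝ) ≤ 3 / 4),
      show (3 / 2 : ℝ) * (4 / 3) = ((2 : ℕ) : ℝ) by norm_num, Real.rpow_natCast]
    norm_num
  have hε43 : ε ^ (4 / 3 : ℝ) = 9 / 16 * ε' ^ (4 / 3 : ℝ) := by
    rw [hε, Real.mul_rpow hc0.le hε'0.le, hc43]
  have hM : ε * (1 + Real.log (K ε') + Real.log (K ε') ^ 2 / 2) = 9 / 16 / p := by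
    rw [hlogK, hp, eq_div_iff (Real.rpow_pos_of_pos hε0 _).ne']
    have h1 : ε * ε ^ (1 / 3 : ℝ) = ε ^ (4 / 3 : ℝ) := by
      rw [show (4 / 3 : ℝ) = 1 + 1 / 3 by norm_num, Real.rpow_add hε0, Real.rpow_one]
    have h2 : ε' ^ (-(4 / 3 : ℝ)) * ε' ^ (4 / 3 : ℝ) = 1 := by
      rw [← Real.rpow_add hε'0]; norm_num
    calc ε * ε' ^ (-(4 / 3 : ℝ)) * ε ^ (1 / 3 : ℝ)
        = (ε * ε ^ (1 / 3 : ℝ)) * ε' ^ (-(4 / 3 : ℝ)) := by ring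
      _ = 9 / 16 * (ε' ^ (-(4 / 3 : ℝ)) * ε' ^ (4 / 3 : ℝ)) := by rw [h1, hε43]; ring
      _ = 9 / 16 := by rw [h2, mul_one]
  -- (ii) the threshold `|ln r|^{-3/2} ≤ ε` on `(0, r₀]`
  have hthr' : ∀ r : ℝ, 0 < r → r ≤ r₀ → |Real.log r| ^ (-(3 / 2 : ℝ)) ≤ ε := by
    intro r hr hrr₀
    have h1 := hthr r hr hrr₀
    have h2 : |Real.log r| ^ (-(3 / 2 : ℝ)) = c * ((3 / 4 : ℝ) * |Real.log r|) ^ (-(3 / 2 : ℝ)) := by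
      rw [Real.mul_rpow (by norm_num : (0 : ℝ) ≤ 3 / 4) (abs_nonneg _), ← mul_assoc, hc,
        ← Real.rpow_add (by norm_num : (0 : ℝ) < 3 / 4)]
      norm_num
    rw [h2, hε]
    exact mul_le_mul_of_nonneg_left h1.le hc0.le
  -- (iii) condition (a)' via `F_gt_of_threshold`
  have hKK₀ : K₀ ε' ≤ Cs * (ε ^ (4 / 3 : ℝ) * K ε') := by
    have h1 := K₀_le_exp_three_mul hε'0 hε'1
    have h2 : ε' ^ (4 / 3 : ℝ) = 16 / 9 * ε ^ (4 / 3 : ℝ) := by rw [hε43]; ring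
    rw [h2] at h1
    calc K₀ ε' ≤ Real.exp 3 * (16 / 9 * ε ^ (4 / 3 : ℝ) * K ε') := h1
      _ = Cs * (ε ^ (4 / 3 : ℝ) * K ε') := by rw [hCs]; ring
  have hK₀X : K₀ ε' = X + 1 := by
    rw [K₀, hε', ← Real.rpow_mul hL0.le, show (-(3 / 2 : ℝ)) * (-(2 / 3 : ℝ)) = 1 by norm_num,
      Real.rpow_one, hL, show 1 + Real.log (X + 1) - 1 = Real.log (X + 1) by ring,
      Real.exp_log (by linarith)]
  have hb : C₀ * max ((N₀ * ((1 + Γb) * E₀) ^ 3) ^ (1 / 4 : ℝ))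
      (r₀ ^ (-(1 / 2 : ℝ)) * ((1 + Γb) * E₀)) < K₀ ε' := by
    rw [← hM₁, hmax, hK₀X, hX]
    exact lt_add_one _
  have hA₀0 : 0 ≤ IJ + p ^ 2 / 2 * IΩ := by positivity
  have hA₀N : IJ + p ^ 2 / 2 * IΩ ≤ N₀ ^ 2 := by
    have h1 : Real.sqrt IJ ^ 2 = IJ := Real.sq_sqrt hIJ
    have h2 : Real.sqrt IΩ ^ 2 = IΩ := Real.sq_sqrt hIΩ
    have h3 : 0 ≤ Real.sqrt IJ * Real.sqrt IΩ := by positivity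
    have h4 : p ^ 2 ≤ 1 := pow_le_one₀ hp0.le hp1
    have h5 : p ^ 2 / 2 * IΩ ≤ IΩ := by nlinarith
    rw [hN₀]; nlinarith
  have hM₂0 : 0 ≤ 9 / 16 + p * Γb + Γb ^ 2 / p ^ 2 := by positivity
  have hM₂le : 9 / 16 + p * Γb + Γb ^ 2 / p ^ 2 ≤ ε ^ (-(2 / 3 : ℝ)) * (1 + Γb) ^ 2 := by
    have h1 := M₂_le hε0 hε1 hΓb
    have h2 : Γb ^ 2 / p ^ 2 = ε ^ (-(2 / 3 : ℝ)) * Γb ^ 2 := by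
      rw [hp2, Real.rpow_neg hε0.le, div_eq_mul_inv, mul_comm]
    rw [h2, hp]
    linarith
  have hgt := F_gt_of_threshold (ε := ε) (K := K ε') (K₀ := K₀ ε') (Cs := Cs) (C₀ := C₀) (C₁ := C₁)
    (r₀ := r₀) (E₀ := E₀) (N₀ := N₀) (Γ₀ := Γb) (A₀ := IJ + p ^ 2 / 2 * IΩ)
    (M₂ := 9 / 16 + p * Γb + Γb ^ 2 / p ^ 2)
    hε0 hε1 (K_pos ε') (K₀_pos ε').le hCs0 hKK₀ hC₁0 (le_of_eq hC₀.symm) hr₀ hE₀0.le hN₀0 hΓb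
    hA₀0 hA₀N hM₂0 hM₂le hb
  -- `C_g M₂ E ≤ C₁ M₂ E₀²`
  have hKEle : KE ≤ E₀ ^ 2 := by
    have h1 : Real.sqrt KE ^ 2 = KE := Real.sq_sqrt hKE
    have h2 : 0 ≤ Real.sqrt KE := Real.sqrt_nonneg _
    rw [hE₀]; nlinarith
  have hfinal : Cg * (9 / 16 + p * Γb + Γb ^ 2 / p ^ 2) * KE ≤
      C₁ * (9 / 16 + p * Γb + Γb ^ 2 / p ^ 2) * E₀ ^ 2 := by
    have h1 : Cg ≤ C₁ := by rw [hC₁]; linarith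
    exact mul_le_mul (mul_le_mul_of_nonneg_right h1 hM₂0) hKEle hKE (by positivity)
  exact ⟨ε, p, K ε', r₀, hε0, hε1, hp0, hp3, hK1, hr₀, hr₀δ, hM, hthr', hfinal.trans_lt hgt⟩

end Wei2016

/-! ### The uniform `L⁴` a-priori bound under (1.6) -/

section Main

set_option maxHeartbeats 1600000 in
/-- **Wei 2016, proof of Thm. 1.1 / Cor. 1.1 up to "`v ∈ L^∞L⁴`"** (arXiv:1508.03318, §3; the
end-game "as in [8]" = Lei–Zhang 2017, §3 p. 9), in Tao's smooth class: for `δ₀ ∈ (0, 1/2)`,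
`T > 0` and a smooth divergence-free rapidly decaying `H^∞` axisymmetric datum `u₀` with
`Γ₀ ∈ L^∞` there is `N ≥ 0` such that every Tao-class solution `v` (`ν = 1`) from `u₀` on
`[0, T'] ⊆ [0, T]` with axisymmetric slices obeying (1.6), `|Γ(t, x)| ≤ |ln r|^{-3/2}` for
`t ∈ [0, T')`, `0 < r ≤ δ₀`, satisfies `‖v(t)‖_{L⁴} ≤ N` on `[0, T']`. Chain: parameters
(`Wei2016.exists_parameters`) → `|Γ| ≤ ε` on `r ≤ r₀`, `|Γ| ≤ ‖Γ₀‖_∞` (max principle) →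
`F(A(0)) − C_gM₂E ≤ F(A(t))` (`F_energyA_le`) and (a)' → `A ≤ Y` (`le_of_F_sub_le`) →
`∫₀ᵗ‖∇Ω‖² ≤ D` (`intervalIntegral_dissipation_le`) → `∫₀ᵗ‖vʳ/r‖_∞ ≤ Λ`
(`exists_radVelQuot_bound`) → `‖v^θ‖₄⁴ ≤ A'`, `‖ω^θ‖₂² ≤ Y_ω` (`swirlL4_apriori`,
`omegaTheta_apriori`) → `‖v‖₄ ≤ N` (`eLpNorm_four_le_of_bounds'`).
[cite: Wei2016, proof of Thm. 1.1 and Cor. 1.1 (§3)] -/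
theorem Wei2016_aprioriL4_logModulus ⦃δ₀ : ℝ⦄ (hδ₀ : 0 < δ₀) (hδ₀1 : δ₀ < 1 / 2) ⦃T : ℝ⦄ (hT : 0 < T)
    ⦃u₀ : EuclideanSpace ℝ (Fin 3) → EuclideanSpace ℝ (Fin 3)⦄
    (hsm : ContDiff ℝ ∞ u₀) (_hdiv : VectorCalculus.IsDivFree u₀) (_hdec : HasRapidSpatialDecay u₀)
    (_hH : ∀ n : ℕ, ∫⁻ x, ‖iteratedFDeriv ℝ n u₀ x‖ₑ ^ 2 < ⊤) (_haxi : IsAxisymmetric u₀)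
    (hΓi : eLpNorm (swirl u₀) ⊤ volume < ⊤) :
    ∃ N : ℝ, 0 ≤ N ∧ ∀ ⦃T' : ℝ⦄, 0 < T' → T' ≤ T →
      ∀ ⦃v : ℝ → EuclideanSpace ℝ (Fin 3) → EuclideanSpace ℝ (Fin 3)⦄
        ⦃q : ℝ → EuclideanSpace ℝ (Fin 3) → ℝ⦄,
        IsTaoSolutionOn T' 1 u₀ v q →
        (∀ t ∈ Icc 0 T', IsAxisymmetric (v t)) →
        (∀ t ∈ Ico 0 T', ∀ x : EuclideanSpace ℝ (Fin 3), 0 < cylRadius x →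
            cylRadius x ≤ δ₀ → |swirl (v t) x| ≤ |Real.log (cylRadius x)| ^ (-(3 / 2 : ℝ))) →
        ∀ t ∈ Icc 0 T', eLpNorm (v t) 4 volume ≤ ENNReal.ofReal N := by
  have hρ0x : ∀ x : EuclideanSpace ℝ (Fin 3), 0 ≤ x 0 ^ 2 + x 1 ^ 2 := fun x => by positivity
  ------------------------------------------------------------------
  -- datum constants
  ------------------------------------------------------------------
  have cΓ : Continuous (swirl u₀) := (contDiff_swirl hsm).continuous
  obtain ⟨Γb, hΓb_def⟩ : ∃ M : ℝ, M = (eLpNorm (swirl u₀) ⊤ volume).toReal := ⟨_, rfl⟩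
  have hΓbx : ∀ x, |swirl u₀ x| ≤ Γb := fun x =>
    hΓb_def ▸ abs_le_toReal_eLpNorm_top_of_continuous cΓ hΓi x
  have hΓb0 : 0 ≤ Γb := by rw [hΓb_def]; exact ENNReal.toReal_nonneg
  have hKE0 : 0 ≤ VectorCalculus.kineticEnergy u₀ := kineticEnergy_nonneg u₀
  obtain ⟨IJ₀, hIJ₀⟩ : ∃ I : ℝ, I = ∫ x, radVelQuot (curl u₀) x ^ 2 := ⟨_, rfl⟩
  have hIJ₀0 : 0 ≤ IJ₀ := by rw [hIJ₀]; exact integral_nonneg fun x => sq_nonneg _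
  obtain ⟨IΩ₀, hIΩ₀⟩ : ∃ I : ℝ, I = ∫ x, angVortQuot u₀ x ^ 2 := ⟨_, rfl⟩
  have hIΩ₀0 : 0 ≤ IΩ₀ := by rw [hIΩ₀]; exact integral_nonneg fun x => sq_nonneg _
  obtain ⟨Cg, hCg⟩ : ∃ Cg : ℝ, Cg = Wei2016.hardyConst * ((4 : ℝ) ^ (2 / 3 : ℝ) *
          (192 + 8 * ‖(curlCLM : (EuclideanSpace ℝ (Fin 3) →L[ℝ] EuclideanSpace ℝ (Fin 3)) →L[ℝ]
            EuclideanSpace ℝ (Fin 3))‖ ^ 2) ^ (1 / 3 : ℝ) * ((radialConst₂ ^ 2)⁻¹) ^ (2 / 3 : ℝ) +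
          (192 + 8 * ‖(curlCLM : (EuclideanSpace ℝ (Fin 3) →L[ℝ] EuclideanSpace ℝ (Fin 3)) →L[ℝ]
            EuclideanSpace ℝ (Fin 3))‖ ^ 2)) := ⟨_, rfl⟩
  have hCg0 : 0 ≤ Cg := by
    rw [hCg]
    have h0 : 0 ≤ ‖(curlCLM : (EuclideanSpace ℝ (Fin 3) →L[ℝ] EuclideanSpace ℝ (Fin 3)) →L[ℝ]
        EuclideanSpace ℝ (Fin 3))‖ :=
      norm_nonneg (curlCLM : (EuclideanSpace ℝ (Fin 3) →L[ℝ] EuclideanSpace ℝ (Fin 3)) →L[ℝ]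
        EuclideanSpace ℝ (Fin 3))
    exact mul_nonneg Wei2016.hardyConst_nonneg (by positivity)
  ------------------------------------------------------------------
  -- the parameters `ε, p, K, r₀` (Cor. 1.1 + "(b) ⇒ (a)'")
  ------------------------------------------------------------------
  obtain ⟨ε, p, K, r₀, hε, hε1, hp, hp3, hK1, hr₀, hr₀δ, hM, hthr, hgap⟩ :=
    Wei2016.exists_parameters hδ₀ hΓb0 hKE0 hIJ₀0 hIΩ₀0 hCg0
  obtain ⟨κ, hκ⟩ : ∃ k : ℝ, k = (ε * K) ^ (8 / 3 : ℝ) := ⟨_, rfl⟩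
  have hκ0 : 0 < κ := by rw [hκ]; exact Real.rpow_pos_of_pos (mul_pos hε (by linarith)) _
  obtain ⟨ρ, hρ⟩ : ∃ r : ℝ, r = (r₀ ^ 4)⁻¹ := ⟨_, rfl⟩
  have hρ0 : 0 < ρ := by rw [hρ]; exact inv_pos.2 (pow_pos hr₀ 4)
  obtain ⟨M₂, hM₂⟩ : ∃ M : ℝ, M = 9 / 16 + p * Γb + Γb ^ 2 / p ^ 2 := ⟨_, rfl⟩
  have hM₂0 : 0 ≤ M₂ := by rw [hM₂]; positivity
  obtain ⟨A₀, hA₀⟩ : ∃ A : ℝ, A = IJ₀ + p ^ 2 / 2 * IΩ₀ := ⟨_, rfl⟩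
  have hA₀0 : 0 ≤ A₀ := by rw [hA₀]; positivity
  obtain ⟨G, hG⟩ : ∃ G : ℝ, G = Cg * M₂ * VectorCalculus.kineticEnergy u₀ := ⟨_, rfl⟩
  have hG0 : 0 ≤ G := by rw [hG]; positivity
  have hGlt : G < Wei2016.F κ ρ A₀ := by rw [hG, hM₂, hκ, hρ, hA₀]; exact hgap
  obtain ⟨Y, hY⟩ : ∃ Y : ℝ, Y = max (Wei2016.yJ κ ρ) ((3 * κ / (Wei2016.F κ ρ A₀ - G)) ^ 3) := ⟨_, rfl⟩
  have hY0 : 0 < Y := by rw [hY]; exact lt_max_of_lt_left (Wei2016.yJ_pos hκ0 hρ0)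
  obtain ⟨MΩ, hMΩ⟩ : ∃ M : ℝ, M = 2 * Y / p ^ 2 := ⟨_, rfl⟩
  have hMΩ0 : 0 ≤ MΩ := by rw [hMΩ]; positivity
  obtain ⟨D, hD⟩ : ∃ D : ℝ, D = (A₀ + G * max (Y ^ (4 / 3 : ℝ) / κ) ρ) / ((1 - 9 / 16) * p ^ 2) :=
    ⟨_, rfl⟩
  have hMx0 : 0 ≤ max (Y ^ (4 / 3 : ℝ) / κ) ρ := le_max_of_le_right hρ0.le
  have hD0 : 0 ≤ D := by rw [hD]; positivity
  obtain ⟨CA, hCA⟩ : ∃ C : ℝ, C = Real.sqrt newtonNearSqInt + newtonFarLaplacianL65 *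
      SNormLESNormFDerivOfEqConst ℝ (volume : Measure (EuclideanSpace ℝ (Fin 3))) 2 := ⟨_, rfl⟩
  have hCA0 : 0 ≤ CA := by rw [hCA]; have := newtonFarLaplacianL65_nonneg; positivity
  obtain ⟨Λ, hΛ⟩ : ∃ L : ℝ, L = CA * MΩ ^ (1 / 4 : ℝ) * (3 * T / 4 + D / 4) := ⟨_, rfl⟩
  have hΛ0 : 0 ≤ Λ := by rw [hΛ]; positivity
  obtain ⟨S₀, hS₀⟩ : ∃ S : ℝ, S = ∫ x, swirl u₀ x ^ 2 * angVelQuot u₀ x ^ 2 := ⟨_, rfl⟩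
  have hS₀0 : 0 ≤ S₀ := by rw [hS₀]; exact integral_nonneg fun x => by positivity
  obtain ⟨W₀, hW₀⟩ : ∃ W : ℝ, W = ∫ x : EuclideanSpace ℝ (Fin 3),
      (x 0 ^ 2 + x 1 ^ 2) * angVortQuot u₀ x ^ 2 := ⟨_, rfl⟩
  have hW₀0 : 0 ≤ W₀ := by rw [hW₀]; exact integral_nonneg fun x => mul_nonneg (hρ0x x) (sq_nonneg _)
  obtain ⟨A', hA'⟩ : ∃ A : ℝ, A = S₀ * Real.exp (4 * Λ) := ⟨_, rfl⟩
  have hA'0 : 0 ≤ A' := by rw [hA']; positivity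
  obtain ⟨Ψ, hΨ⟩ : ∃ P : ℝ, P = S₀ / 4 + S₀ * Real.exp (4 * Λ) * Λ := ⟨_, rfl⟩
  have hΨ0 : 0 ≤ Ψ := by rw [hΨ]; positivity
  obtain ⟨Yω, hYω⟩ : ∃ Yw : ℝ, Yw = (W₀ + 2 * Ψ) * Real.exp (2 * Λ) := ⟨_, rfl⟩
  have hYω0 : 0 ≤ Yω := by rw [hYω]; positivity
  have hKS0 : 0 ≤ (SNormLESNormFDerivOfEqConst (EuclideanSpace ℝ (Fin 3))
      (volume : Measure (EuclideanSpace ℝ (Fin 3))) 2 : ℝ) := NNReal.coe_nonneg _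
  obtain ⟨N₁, hN₁⟩ : ∃ N : ℝ, N = A' ^ (1 / 4 : ℝ) := ⟨_, rfl⟩
  obtain ⟨N₂, hN₂⟩ : ∃ N : ℝ, N = (Real.sqrt (4 * (2 * VectorCalculus.kineticEnergy u₀)) *
      ((SNormLESNormFDerivOfEqConst (EuclideanSpace ℝ (Fin 3))
        (volume : Measure (EuclideanSpace ℝ (Fin 3))) 2 : ℝ) * Real.sqrt Yω) ^ 3) ^ (1 / 4 : ℝ) :=
    ⟨_, rfl⟩
  have hN₁0 : 0 ≤ N₁ := by rw [hN₁]; exact Real.rpow_nonneg hA'0 _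
  have hN₂0 : 0 ≤ N₂ := by rw [hN₂]; exact Real.rpow_nonneg (by positivity) _
  refine ⟨N₁ + N₂, add_nonneg hN₁0 hN₂0, ?_⟩
  ------------------------------------------------------------------
  -- a solution on `[0, T']`
  ------------------------------------------------------------------
  intro T' hT' hT'T v q h hax hmod t ht
  have hsmv : IsSmoothSpaceTimeOn (Icc 0 T') v := h.classical.smooth_velocity
  have hvs : ∀ s ∈ Icc 0 T', ContDiff ℝ ∞ (v s) := fun s hs => h.classical.contDiff_velocity hs
  have hv2 : ∀ s ∈ Icc 0 T', ContDiff ℝ 2 (v s) := fun s hs => (hvs s hs).of_le (by norm_cast)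
  have hne := norm_euclideanSpace_single_one_le
  -- Step 1: `|Γ| ≤ Γ_b` everywhere and `|Γ| ≤ ε` on `r ≤ r₀` (max principle; (1.6) + continuity)
  have hΓbt : ∀ s ∈ Icc 0 T', ∀ x, |swirl (v s) x| ≤ Γb := h.abs_swirl_le one_pos hT' hax hΓbx
  have hΓε : ∀ s ∈ Icc 0 T', ∀ x, 0 < cylRadius x → cylRadius x ≤ r₀ → |swirl (v s) x| ≤ ε := by
    intro s hs x hxr hxr₀
    have hcont : ContinuousOn (fun τ => |swirl (v τ) x|) (Icc 0 T') := by
      have h0 : ContinuousOn (fun τ => v τ x) (Icc 0 T') := hsmv.continuousOn_time x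
      have h1 : ContinuousOn (fun τ => (v τ x) 1) (Icc 0 T') :=
        (EuclideanSpace.proj (1 : Fin 3)).continuous.comp_continuousOn h0
      have h2 : ContinuousOn (fun τ => (v τ x) 0) (Icc 0 T') :=
        (EuclideanSpace.proj (0 : Fin 3)).continuous.comp_continuousOn h0
      have h3 : ContinuousOn (fun τ => swirl (v τ) x) (Icc 0 T') := by
        simp only [swirl]
        exact (continuousOn_const.mul h1).sub (continuousOn_const.mul h2)
      exact continuous_abs.comp_continuousOn h3
    refine le_on_Icc_of_le_on_Ico hT' hcont (fun τ hτ => ?_) s hs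
    exact (hmod τ hτ x hxr (hxr₀.trans (hr₀δ.le))).trans (hthr _ hxr hxr₀)
  -- Step 2: the `F`-comparison and (a)' ⟹ `A(s) ≤ Y`
  have hF := h.F_energyA_le hT' hax hε hε1 hp hp3 (by norm_num : (0 : ℝ) ≤ 9 / 16)
    (by norm_num : (9 / 16 : ℝ) ≤ 1) hK1 hr₀ hΓb0 hM hΓε hΓbt
  have hAY : ∀ s ∈ Icc 0 T',
      (∫ x, radVelQuot (curl (v s)) x ^ 2) + p ^ 2 / 2 * ∫ x, angVortQuot (v s) x ^ 2 ≤ Y := by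
    intro s hs
    have h1 := hF s hs
    rw [h.initial] at h1
    have h2 : Wei2016.F κ ρ A₀ - G ≤
        Wei2016.F κ ρ ((∫ x, radVelQuot (curl (v s)) x ^ 2) + p ^ 2 / 2 * ∫ x, angVortQuot (v s) x ^ 2) := by
      rw [hκ, hρ, hG, hCg, hM₂, hA₀, hIJ₀, hIΩ₀]
      exact h1
    have h3 := Wei2016.le_of_F_sub_le hκ0 hρ0 h2 hGlt
    rw [← hY] at h3
    exact h3
  -- Step 3: `∫ Ω(s)² ≤ M_Ω`
  have hΩs : ∀ s ∈ Icc 0 T', ∫ x, angVortQuot (v s) x ^ 2 ≤ MΩ := by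
    intro s hs
    have h1 := hAY s hs
    have h2 : 0 ≤ ∫ x, radVelQuot (curl (v s)) x ^ 2 := integral_nonneg fun x => sq_nonneg _
    have hp2 : 0 < p ^ 2 := pow_pos hp 2
    rw [hMΩ, le_div_iff₀ hp2]
    nlinarith
  -- Step 4: the time-integrated dissipation `∫₀ˢ ∫ |∇Ω|² ≤ D`
  have hdis := h.intervalIntegral_dissipation_le hT' hax hε hε1 hp hp3 (by norm_num : (0 : ℝ) ≤ 9 / 16)
    (by norm_num : (9 / 16 : ℝ) < 1) hK1 hr₀ hΓb0 hM hΓε hΓbt (Y := Y) hAY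
  have hDfull : ∀ s ∈ Icc 0 T', ∫ τ in (0 : ℝ)..s, ∫ x,
      (fderiv ℝ (angVortQuot (v τ)) x (EuclideanSpace.single 0 1) ^ 2 +
        fderiv ℝ (angVortQuot (v τ)) x (EuclideanSpace.single 1 1) ^ 2 +
        fderiv ℝ (angVortQuot (v τ)) x (EuclideanSpace.single 2 1) ^ 2) ≤ D := by
    intro s hs
    have h1 := hdis s hs
    rw [h.initial] at h1
    have h2 : (1 - 9 / 16) * p ^ 2 * ∫ τ in (0 : ℝ)..s, ∫ x,
        (fderiv ℝ (angVortQuot (v τ)) x (EuclideanSpace.single 0 1) ^ 2 +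
          fderiv ℝ (angVortQuot (v τ)) x (EuclideanSpace.single 1 1) ^ 2 +
          fderiv ℝ (angVortQuot (v τ)) x (EuclideanSpace.single 2 1) ^ 2) ≤
        A₀ + G * max (Y ^ (4 / 3 : ℝ) / κ) ρ := by
      rw [hA₀, hIJ₀, hIΩ₀, hG, hCg, hM₂, hκ, hρ]
      exact h1
    have hc0 : 0 < (1 - 9 / 16) * p ^ 2 := by positivity
    rw [hD, le_div_iff₀ hc0]
    linarith
  -- the `∂_z`-part of the dissipation is at most the full one
  obtain ⟨hc2, hi2⟩ := h.continuousOn_dissipation_angVortQuot hT' hax (hne 2)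
  obtain ⟨hc1, hi1⟩ := h.continuousOn_dissipation_angVortQuot hT' hax (hne 1)
  obtain ⟨hc0', hi0⟩ := h.continuousOn_dissipation_angVortQuot hT' hax (hne 0)
  have hsplit : ∀ τ ∈ Icc 0 T', ∫ x,
      (fderiv ℝ (angVortQuot (v τ)) x (EuclideanSpace.single 0 1) ^ 2 +
        fderiv ℝ (angVortQuot (v τ)) x (EuclideanSpace.single 1 1) ^ 2 +
        fderiv ℝ (angVortQuot (v τ)) x (EuclideanSpace.single 2 1) ^ 2) =
      (∫ x, fderiv ℝ (angVortQuot (v τ)) x (EuclideanSpace.single 0 1) ^ 2) +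
        (∫ x, fderiv ℝ (angVortQuot (v τ)) x (EuclideanSpace.single 1 1) ^ 2) +
        ∫ x, fderiv ℝ (angVortQuot (v τ)) x (EuclideanSpace.single 2 1) ^ 2 := by
    intro τ hτ
    have e1 : ∫ x, (fderiv ℝ (angVortQuot (v τ)) x (EuclideanSpace.single 0 1) ^ 2 +
          fderiv ℝ (angVortQuot (v τ)) x (EuclideanSpace.single 1 1) ^ 2 +
          fderiv ℝ (angVortQuot (v τ)) x (EuclideanSpace.single 2 1) ^ 2) =
        (∫ x, (fderiv ℝ (angVortQuot (v τ)) x (EuclideanSpace.single 0 1) ^ 2 +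
          fderiv ℝ (angVortQuot (v τ)) x (EuclideanSpace.single 1 1) ^ 2)) +
          ∫ x, fderiv ℝ (angVortQuot (v τ)) x (EuclideanSpace.single 2 1) ^ 2 :=
      integral_add ((hi0 τ hτ).add (hi1 τ hτ)) (hi2 τ hτ)
    have e2 : ∫ x, (fderiv ℝ (angVortQuot (v τ)) x (EuclideanSpace.single 0 1) ^ 2 +
          fderiv ℝ (angVortQuot (v τ)) x (EuclideanSpace.single 1 1) ^ 2) =
        (∫ x, fderiv ℝ (angVortQuot (v τ)) x (EuclideanSpace.single 0 1) ^ 2) +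
          ∫ x, fderiv ℝ (angVortQuot (v τ)) x (EuclideanSpace.single 1 1) ^ 2 :=
      integral_add (hi0 τ hτ) (hi1 τ hτ)
    rw [e1, e2]
  have hDz : ∀ s ∈ Icc 0 T', ∫ τ in (0 : ℝ)..s, ∫ x,
      fderiv ℝ (angVortQuot (v τ)) x (EuclideanSpace.single 2 1) ^ 2 ≤ D := by
    intro s hs
    refine le_trans ?_ (hDfull s hs)
    have hsub : Icc 0 s ⊆ Icc 0 T' := Icc_subset_Icc_right hs.2
    have hcsum : ContinuousOn (fun τ => ∫ x,
        (fderiv ℝ (angVortQuot (v τ)) x (EuclideanSpace.single 0 1) ^ 2 +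
          fderiv ℝ (angVortQuot (v τ)) x (EuclideanSpace.single 1 1) ^ 2 +
          fderiv ℝ (angVortQuot (v τ)) x (EuclideanSpace.single 2 1) ^ 2)) (Icc 0 T') :=
      ((hc0'.add hc1).add hc2).congr fun τ hτ => hsplit τ hτ
    refine intervalIntegral.integral_mono_on hs.1
      ((hc2.mono hsub).intervalIntegrable_of_Icc hs.1)
      ((hcsum.mono hsub).intervalIntegrable_of_Icc hs.1) fun τ hτ => ?_
    rw [hsplit τ (hsub hτ)]
    have h0 : 0 ≤ ∫ x, fderiv ℝ (angVortQuot (v τ)) x (EuclideanSpace.single 0 1) ^ 2 :=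
      integral_nonneg fun x => sq_nonneg _
    have h1 : 0 ≤ ∫ x, fderiv ℝ (angVortQuot (v τ)) x (EuclideanSpace.single 1 1) ^ 2 :=
      integral_nonneg fun x => sq_nonneg _
    linarith
  -- Step 5: `|vʳ/r| ≤ a(t)`, `∫₀^{T'} a ≤ Λ`
  obtain ⟨a, hac, ha0, haW, haI⟩ := h.exists_radVelQuot_bound hT' hax hMΩ0 hΩs hDz
  have hβ0 : ∀ s, 0 ≤ |a s| := fun s => abs_nonneg _
  have hβc : ContinuousOn (fun s => |a s|) (Icc 0 T') := continuous_abs.comp_continuousOn hac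
  have hβi : IntegrableOn (fun s => |a s|) (Ioo 0 T') volume :=
    (hβc.integrableOn_Icc).mono_set Ioo_subset_Icc_self
  have hWβ : ∀ s ∈ Ioo 0 T', ∀ x, |radVelQuot (v s) x| ≤ |a s| := fun s hs x =>
    (haW s (Ioo_subset_Icc_self hs) x).trans (le_abs_self _)
  have hIβ : ∫ s in Ioo 0 T', |a s| ≤ Λ := by
    have h1 : ∫ s in Ioo 0 T', |a s| = ∫ s in Ioo 0 T', a s :=
      setIntegral_congr_fun measurableSet_Ioo fun s hs => abs_of_nonneg (ha0 s (Ioo_subset_Icc_self hs))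
    have h2 : ∫ s in Ioo 0 T', a s = ∫ s in (0 : ℝ)..T', a s := by
      rw [intervalIntegral.integral_of_le hT'.le, integral_Ioc_eq_integral_Ioo]
    rw [h1, h2]
    refine (haI T' ⟨hT'.le, le_rfl⟩).trans ?_
    rw [← hCA, hΛ]
    have h3 : 3 * T' / 4 + D / 4 ≤ 3 * T / 4 + D / 4 := by linarith
    exact mul_le_mul_of_nonneg_left h3 (mul_nonneg hCA0 (Real.rpow_nonneg hMΩ0 _))
  have hIβ0 : 0 ≤ ∫ s in Ioo 0 T', |a s| := setIntegral_nonneg measurableSet_Ioo fun s _ => hβ0 s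
  -- Step 6: `‖v^θ(t)‖⁴₄ ≤ A'` and the forcing majorant `ψ`
  obtain ⟨hS4, ψ, hψi, hψb, hψ0, hψI⟩ := h.swirlL4_apriori hT' one_pos hax hΓbt hβ0 hβi hWβ ht
  have hexp4 : Real.exp (4 * ∫ s in Ioo 0 T', |a s|) ≤ Real.exp (4 * Λ) :=
    Real.exp_le_exp.2 (by linarith)
  have hexp2 : Real.exp (2 * ∫ s in Ioo 0 T', |a s|) ≤ Real.exp (2 * Λ) :=
    Real.exp_le_exp.2 (by linarith)
  have hS4t : ∫ x, swirl (v t) x ^ 2 * angVelQuot (v t) x ^ 2 ≤ A' := by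
    rw [h.initial, ← hS₀] at hS4
    refine hS4.trans ?_
    rw [hA']
    exact mul_le_mul_of_nonneg_left hexp4 hS₀0
  have hA't : ∫ x : EuclideanSpace ℝ (Fin 3), (x 0 ^ 2 + x 1 ^ 2) ^ 2 * angVelQuot (v t) x ^ 4 ≤ A' := by
    have heq : (fun x : EuclideanSpace ℝ (Fin 3) => (x 0 ^ 2 + x 1 ^ 2) ^ 2 * angVelQuot (v t) x ^ 4) =
        fun x => swirl (v t) x ^ 2 * angVelQuot (v t) x ^ 2 := by
      funext x
      rw [← (hax t ht).cylRadius_sq_mul_angVelQuot (hv2 t ht) x, ← cylRadius_sq]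
      ring
    rw [heq]
    exact hS4t
  have hΨt : ∫ s in Ioo 0 T', ψ s ≤ Ψ := by
    have h1 := hψI T' ⟨hT', le_rfl⟩
    rw [h.initial, ← hS₀] at h1
    refine h1.trans ?_
    rw [hΨ]
    have h2 : S₀ * Real.exp (4 * ∫ s in Ioo 0 T', |a s|) * ∫ s in Ioo 0 T', |a s| ≤
        S₀ * Real.exp (4 * Λ) * Λ :=
      mul_le_mul (mul_le_mul_of_nonneg_left hexp4 hS₀0) hIβ hIβ0 (by positivity)
    linarith
  -- Step 7: `‖ω^θ(t)‖²₂ ≤ Y_ω`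
  have hPle : ∀ s ∈ Ioo 0 T', ∫ x : EuclideanSpace ℝ (Fin 3),
      (x 0 ^ 2 + x 1 ^ 2) * angVelQuot (v s) x ^ 4 ≤ 2 * ψ s := by
    intro s hs
    have hsI : s ∈ Icc 0 T' := Ioo_subset_Icc_self hs
    have heq : (fun x : EuclideanSpace ℝ (Fin 3) => (x 0 ^ 2 + x 1 ^ 2) * angVelQuot (v s) x ^ 4) =
        fun x => swirl (v s) x * angVelQuot (v s) x ^ 3 := by
      funext x
      rw [← (hax s hsI).cylRadius_sq_mul_angVelQuot (hv2 s hsI) x, ← cylRadius_sq]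
      ring
    rw [heq]
    have h1 := hψb s hs
    have h2 : 0 ≤ ∫ x, swirl (v s) x ^ 2 *
        (fderiv ℝ (angVelQuot (v s)) x (EuclideanSpace.single 0 1) ^ 2 +
          fderiv ℝ (angVelQuot (v s)) x (EuclideanSpace.single 1 1) ^ 2 +
          fderiv ℝ (angVelQuot (v s)) x (EuclideanSpace.single 2 1) ^ 2) :=
      integral_nonneg fun x => by positivity
    linarith
  have hPm0 : ∀ s ∈ Ioo 0 T', 0 ≤ 2 * ψ s := fun s hs => by have := hψ0 s hs; positivity
  have hPmi : IntegrableOn (fun s => 2 * ψ s) (Ioo 0 T') volume := hψi.const_mul 2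
  have hω := h.omegaTheta_apriori hT' hax hβ0 hβi hWβ hPm0 hPmi hPle ht
  have hYωt : ∫ x : EuclideanSpace ℝ (Fin 3), (x 0 ^ 2 + x 1 ^ 2) * angVortQuot (v t) x ^ 2 ≤ Yω := by
    refine hω.trans ?_
    rw [h.initial, ← hW₀, hYω]
    have h1 : ∫ s in Ioo 0 T', 2 * ψ s ≤ 2 * Ψ := by
      rw [integral_const_mul]
      linarith
    have h2 : 0 ≤ ∫ s in Ioo 0 T', 2 * ψ s := setIntegral_nonneg measurableSet_Ioo hPm0
    exact mul_le_mul (by linarith) hexp2 (Real.exp_pos _).le (by positivity)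
  -- Step 8: the `L⁴` bound
  have h4 := h.eLpNorm_four_le_of_bounds' hT' zero_le_one hax ht hA't hYωt
  rw [ENNReal.ofReal_add hN₁0 hN₂0, hN₁, hN₂]
  exact h4

end Main

/-! ### The discharges -/

/-- **Wei 2016, the a-priori enstrophy bound behind Cor. 1.1 — discharged.** The named fact
`Wei2016_aprioriEnstrophy_logModulus` (`Wei2016AprioriFact.lean`): under (1.6) every Tao-class
solution from the datum obeys a uniform `H¹` bound, by the uniform `L⁴` bound
(`Wei2016_aprioriL4_logModulus`) and "Serrin type criterion"
(`exists_enstrophy_bound_of_eLpNorm_four_le`, Lei–Zhang 2017, §3 p. 9).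
[cite: Wei2016, proof of Thm. 1.1 and Cor. 1.1 (§3), §1 p. 4] -/
theorem Wei2016_aprioriEnstrophy_logModulus_holds : Wei2016_aprioriEnstrophy_logModulus := by
  intro δ₀ hδ₀ hδ₀1 T hT u₀ hsm hdiv hdec hH haxi hΓi
  obtain ⟨C, hC0, hC⟩ := exists_enstrophy_bound_of_eLpNorm_four_le
  obtain ⟨N, hN, hN4⟩ := Wei2016_aprioriL4_logModulus hδ₀ hδ₀1 hT hsm hdiv hdec hH haxi hΓi
  set G : ℝ := (∫⁻ x, ‖iteratedFDeriv ℝ 1 u₀ x‖ₑ ^ 2).toReal with hG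
  have hGeq : ∫⁻ x, ‖iteratedFDeriv ℝ 1 u₀ x‖ₑ ^ 2 = ENNReal.ofReal G := by
    rw [hG, ENNReal.ofReal_toReal (hH 1).ne]
  refine ⟨3 * Real.exp (C * (T * N ^ 8)) * G, by positivity, ?_⟩
  intro T' hT' hT'T v q h hax hmod t ht
  have h1 := hC one_pos hT' h hN (hN4 hT' hT'T h hax hmod) t ht
  rw [Real.one_rpow, mul_one] at h1
  calc ∫⁻ x, ‖iteratedFDeriv ℝ 1 (v t) x‖ₑ ^ 2
      ≤ ENNReal.ofReal (3 * Real.exp (C * (T' * N ^ 8))) * ∫⁻ x, ‖iteratedFDeriv ℝ 1 u₀ x‖ₑ ^ 2 := h1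
    _ ≤ ENNReal.ofReal (3 * Real.exp (C * (T * N ^ 8))) * ENNReal.ofReal G := by
        rw [hGeq]
        gcongr
    _ = ENNReal.ofReal (3 * Real.exp (C * (T * N ^ 8)) * G) :=
        (ENNReal.ofReal_mul (by positivity)).symm

/-- **Wei 2016, Cor. 1.1 — the named fact `Wei2016_logModulus_regularity` is a theorem**: a
classical axisymmetric Navier–Stokes solution (`ν = 1`) on `[0, T)`, Leray–Hopf from a rapidly
decaying datum with `Γ₀ ∈ L^∞`, obeying `|Γ(t, x)| ≤ |ln r|^{-3/2}` for `0 < r ≤ δ₀ < 1/2`,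
extends smoothly past `T` (by the tree's assembly `Wei2016_logModulus_regularity_holds_of` from
the discharged a-priori bound). [cite: Wei2016, Cor. 1.1] -/
theorem Wei2016_logModulus_regularity_holds : Wei2016_logModulus_regularity :=
  Wei2016_logModulus_regularity_holds_of Wei2016_aprioriEnstrophy_logModulus_holds

/-- **Lei–Zhang 2017, Cor. 1.3 — the named fact `LeiZhang2017_logModulus_regularity` is a
theorem**: a classical axisymmetric Navier–Stokes solution obeying `|Γ(t, x)| ≤ C/|ln r|²` for
`0 < r ≤ δ₀ < 1/2` is regular (from Wei's Cor. 1.1, the modulus `C|ln r|⁻²` being eventually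
below `|ln r|^{-3/2}`: the tree's `LeiZhang2017_logModulus_regularity_of_wei2016`).
[cite: LeiZhang2017, Cor. 1.3] -/
theorem LeiZhang2017_logModulus_regularity_holds : LeiZhang2017_logModulus_regularity :=
  LeiZhang2017_logModulus_regularity_of_wei2016 Wei2016_logModulus_regularity_holds

/-! ### Corollary: a Hölder modulus of the swirl at the axis (Chen–Fang–Zhang 2017, Remark 2) -/

/-- **A Hölder modulus is eventually below Wei's log modulus**: for `C ≥ 0`, `α > 0` there is
`δ₀ ∈ (0, 1/2)` with `C r^α ≤ |ln r|^{-3/2}` for `0 < r ≤ δ₀` (from `|ln r| r^{α/3} < 3/α` on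
`(0, 1]`, `Real.abs_log_mul_self_rpow_lt`: `C r^α |ln r|^{3/2} ≤ C (3/α)^{3/2} r^{α/2}`).
[folklore] -/
private theorem exists_delta_holder_le_logModulus {C α : ℝ} (hC : 0 ≤ C) (hα : 0 < α) :
    ∃ δ₀ : ℝ, 0 < δ₀ ∧ δ₀ < 1 / 2 ∧ ∀ r : ℝ, 0 < r → r ≤ δ₀ →
      C * r ^ α ≤ |Real.log r| ^ (-(3 / 2 : ℝ)) := by
  obtain ⟨Q, hQ⟩ : ∃ Q : ℝ, Q = C * (3 / α) ^ (3 / 2 : ℝ) + 1 := ⟨_, rfl⟩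
  have hP0 : 0 ≤ C * (3 / α) ^ (3 / 2 : ℝ) := by positivity
  have hQ0 : 0 < Q := by rw [hQ]; linarith
  refine ⟨min (1 / 4) (Q ^ (-(2 / α))), lt_min (by norm_num) (Real.rpow_pos_of_pos hQ0 _),
    (min_le_left _ _).trans_lt (by norm_num), fun r hr hrδ => ?_⟩
  have hr1 : r < 1 := by linarith [hrδ.trans (min_le_left _ _)]
  have hL0 : 0 < |Real.log r| := abs_pos.2 (Real.log_neg hr hr1).ne
  obtain ⟨ρ, hρ⟩ : ∃ ρ : ℝ, ρ = r ^ (α / 3) := ⟨_, rfl⟩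
  have hρ0 : 0 < ρ := by rw [hρ]; exact Real.rpow_pos_of_pos hr _
  -- `|ln r| r^{α/3} < 3/α`
  have h1 : |Real.log r| * ρ < 3 / α := by
    have := Real.abs_log_mul_self_rpow_lt r (α / 3) hr hr1.le (by positivity)
    rw [abs_mul, abs_of_pos (Real.rpow_pos_of_pos hr _), one_div_div, ← hρ] at this
    exact this
  have h2 : (|Real.log r| * ρ) ^ (3 / 2 : ℝ) ≤ (3 / α) ^ (3 / 2 : ℝ) :=
    Real.rpow_le_rpow (by positivity) h1.le (by norm_num)
  -- `r^α = ρ^{3/2} ρ^{3/2}`, `ρ^{3/2} = r^{α/2} ≤ Q⁻¹`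
  have hρ3 : r ^ α = ρ ^ (3 / 2 : ℝ) * ρ ^ (3 / 2 : ℝ) := by
    rw [← Real.rpow_add hρ0, hρ, ← Real.rpow_mul hr.le]
    congr 1; ring
  have h3 : ρ ^ (3 / 2 : ℝ) ≤ Q⁻¹ := by
    have hρ32 : ρ ^ (3 / 2 : ℝ) = r ^ (α / 2) := by
      rw [hρ, ← Real.rpow_mul hr.le]; congr 1; ring
    have hexp : (-(2 / α)) * (α / 2) = -1 := by
      field_simp
    rw [hρ32]
    calc r ^ (α / 2) ≤ (Q ^ (-(2 / α))) ^ (α / 2) :=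
          Real.rpow_le_rpow hr.le (hrδ.trans (min_le_right _ _)) (by positivity)
      _ = Q⁻¹ := by rw [← Real.rpow_mul hQ0.le, hexp, Real.rpow_neg_one]
  -- assemble
  have h4 : C * r ^ α * |Real.log r| ^ (3 / 2 : ℝ) ≤ 1 := by
    have e : r ^ α * |Real.log r| ^ (3 / 2 : ℝ) =
        (|Real.log r| * ρ) ^ (3 / 2 : ℝ) * ρ ^ (3 / 2 : ℝ) := by
      rw [hρ3, Real.mul_rpow hL0.le hρ0.le]; ring
    calc C * r ^ α * |Real.log r| ^ (3 / 2 : ℝ)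
        = C * (|Real.log r| * ρ) ^ (3 / 2 : ℝ) * ρ ^ (3 / 2 : ℝ) := by rw [mul_assoc, e, ← mul_assoc]
      _ ≤ C * (3 / α) ^ (3 / 2 : ℝ) * Q⁻¹ :=
          mul_le_mul (mul_le_mul_of_nonneg_left h2 hC) h3 (Real.rpow_nonneg hρ0.le _) hP0
      _ ≤ 1 := by
          rw [mul_inv_le_iff₀ hQ0, one_mul, hQ]
          linarith
  rw [Real.rpow_neg hL0.le, ← one_div, le_div_iff₀ (Real.rpow_pos_of_pos hL0 _)]
  exact h4

/-- **Chen–Fang–Zhang 2017, Remark 2 (Hölder-continuous swirl at the axis), unconditional.**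
"If `r u^θ` is Hölder continuous at the variable `r` uniformly, i.e. there exist `α > 0` and
constant `C` such that `r|u^θ| ≤ C r^α` a.e. `(t, x) ∈ (0, T) × ℝ³`, then `u` is regular"
(arXiv:1505.00905, Remark 2 after Thm. 1.1). In the rendering of the tree's axisymmetric criteria
(`LeiZhang2017AxisymmetricCriteria.lean`): a classical Leray–Hopf solution (`ν = 1`) on `[0, T)`
from a rapidly decaying datum, with axisymmetric slices and `|Γ(t, x)| ≤ C (cylRadius x)^α` on
`[0, T) × ℝ³` (`α > 0`, `C ≥ 0`), extends smoothly past `T`. Proof: the modulus is below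
`|ln r|^{-3/2}` on `0 < r ≤ δ₀(C, α) < 1/2` (`exists_delta_holder_le_logModulus`), so Wei's
Cor. 1.1 (`Wei2016_logModulus_regularity_holds`) applies (`Γ₀ ∈ L^∞` by rapid decay). The tree's
conditional form `ChenFangZhang2017_weightedSwirl_regularity.of_holderSwirl` (from Chen–Fang–Zhang's
Thm. 1.1 (1), undischarged) is thereby superseded for every `α > 0`.
[cite: ChenFangZhang2017, Remark 2] -/
theorem ChenFangZhang2017.holderSwirl_regularity {α C T : ℝ} (hα : 0 < α) (hC : 0 ≤ C)
    {u : ℝ → EuclideanSpace ℝ (Fin 3) → EuclideanSpace ℝ (Fin 3)}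
    {π : ℝ → EuclideanSpace ℝ (Fin 3) → ℝ} (hT : 0 < T)
    (hns : IsClassicalNSSolutionOn (Ico 0 T) 1 0 u π) (hlh : IsLerayHopfOn T 1 0 (u 0) u)
    (hdec : HasRapidSpatialDecay (u 0)) (hax : ∀ t ∈ Ico 0 T, IsAxisymmetric (u t))
    (hmod : ∀ t ∈ Ico 0 T, ∀ x : EuclideanSpace ℝ (Fin 3), |swirl (u t) x| ≤ C * cylRadius x ^ α) :
    HasSmoothExtensionPast 1 0 u T := by
  obtain ⟨δ₀, hδ₀, hδ₀1, hδ⟩ := exists_delta_holder_le_logModulus hC hα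
  exact Wei2016_logModulus_regularity_holds δ₀ hδ₀ hδ₀1 T u π hT hns hlh hdec hax
    hdec.eLpNorm_swirl_lt_top fun t ht x hr hrδ => (hmod t ht x).trans (hδ _ hr hrδ)

end Literature.Analysis.FluidPDE

end
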